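import Mathlib.Geometry.Manifold.PartitionOfUnity
import Mathlib.Analysis.Calculus.BumpFunction.Convolution
import Mathlib.Analysis.Calculus.BumpFunction.FiniteDimension
import Mathlib.Analysis.SpecialFunctions.Integrals.Basic
import Mathlib.MeasureTheory.Measure.Lebesgue.Complex
import HarnessLib

/-!
# Crux `BoundaryClosureR` (stmt-CriticalPhenomena-14004), line `polygon-parity-squeeze`,
# stub `gateProfile_of_identification` (piece F of the (A) assembly): three analytic tools

Pure-analysis helpers for the last step of the identification on exact polygons (the gate profile
law from the local gate identity):

* `apply_eq_zero_of_locally_zero` — LOCAL-TO-GLOBAL for test functions: a functional on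
  `C_c^∞(V)` (`V ⊆ ℂ`), additive on smooth compactly supported functions, which vanishes on the
  test functions supported in some neighbourhood of every point of `V`, vanishes on all of
  `C_c^∞(V)` (finite subcover of the support and a smooth partition of unity subordinate to it);
* `exists_contDiff_dist_le_of_tsupport_subset` — MOLLIFICATION with support control: a continuous
  compactly supported `φ` with `tsupport φ ⊆ V`, `V` open, is the uniform limit of smooth compactly
  supported functions with support in `V` (convolution with a normed bump of small radius);
* `eq_one_of_sandwich` — the DENSITY-AT-A-POINT lemma of the ratio-mixing step: a complex constant
  `K` with `K · P = J` for real `J` pinched between `(1 ∓ γ) V` and complex `P` within `γ V` of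
  `V > 0`, for every `γ > 0`, on both sides, equals `1`;
* slice estimates for flat-top bumps on an interval (`two_mul_le_integral_bump`,
  `integral_bump_le_two_mul`, `norm_integral_bump_mul_sub_le`).

References: L. Hörmander, *The Analysis of Linear Partial Differential Operators I*, Thm. 1.4.4
(partitions of unity) and Thm. 1.3.2 (mollification).
-/

noncomputable section

open scoped Topology ContDiff Manifold BigOperators Convolution
open Set Filter MeasureTheory Metric

namespace Summit.CriticalPhenomena.SAWScalingLimit.Theorems.PolygonParitySqueeze.GateProfile

/-! ### 1. Local-to-global for additive functionals on test functions -/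

/-- An additive functional on `C_c^∞(V)` maps finite sums to finite sums (and the finite sums stay
in `C_c^∞(V)`). [folklore] -/
theorem apply_sum_eq_sum {V : Set ℂ} (T : (ℂ → ℂ) → ℂ)
    (hadd : ∀ φ ψ : ℂ → ℂ, ContDiff ℝ ∞ φ → HasCompactSupport φ → tsupport φ ⊆ V →
      ContDiff ℝ ∞ ψ → HasCompactSupport ψ → tsupport ψ ⊆ V →
        T (fun x => φ x + ψ x) = T φ + T ψ)
    {ι : Type*} (s : Finset ι) (ψ : ι → ℂ → ℂ) (hψ : ∀ i, ContDiff ℝ ∞ (ψ i))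
    (hψc : ∀ i, HasCompactSupport (ψ i)) (hψV : ∀ i, tsupport (ψ i) ⊆ V) :
    ContDiff ℝ ∞ (fun x => ∑ i ∈ s, ψ i x) ∧ HasCompactSupport (fun x => ∑ i ∈ s, ψ i x) ∧
      tsupport (fun x => ∑ i ∈ s, ψ i x) ⊆ V ∧ T (fun x => ∑ i ∈ s, ψ i x) = ∑ i ∈ s, T (ψ i) := by
  classical
  have h0 : T (fun _ => 0) = 0 := by
    have hz : ContDiff ℝ ∞ (fun _ : ℂ => (0 : ℂ)) := contDiff_const
    have hzc : HasCompactSupport (fun _ : ℂ => (0 : ℂ)) := HasCompactSupport.zero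
    have hzV : tsupport (fun _ : ℂ => (0 : ℂ)) ⊆ V := by
      intro x hx
      exact absurd hx (by simp [tsupport])
    have h1 := hadd _ _ hz hzc hzV hz hzc hzV
    simp only [add_zero] at h1
    -- `T 0 + T 0 = T 0 + 0`
    have h2 : T (fun _ => 0) + T (fun _ => 0) = T (fun _ => 0) + 0 := by
      rw [add_zero]; exact h1.symm
    exact add_left_cancel h2
  induction s using Finset.induction_on with
  | empty =>
    simp only [Finset.sum_empty]
    refine ⟨contDiff_const, HasCompactSupport.zero, ?_, h0⟩
    intro x hx
    exact absurd hx (by simp [tsupport])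
  | insert a s ha ih =>
    obtain ⟨ihd, ihc, ihV, ihT⟩ := ih
    simp only [Finset.sum_insert ha]
    refine ⟨(hψ a).add ihd, ?_, ?_, ?_⟩
    · exact (hψc a).add ihc
    · exact (tsupport_add (ψ a) fun x => ∑ i ∈ s, ψ i x).trans (union_subset (hψV a) ihV)
    · rw [hadd _ _ (hψ a) (hψc a) (hψV a) ihd ihc ihV, ihT]

/-- **Local-to-global for test functions.** Let `T` be a functional on functions `ℂ → ℂ`, additive
on smooth compactly supported functions supported in `V`, and suppose every point of `V` has an
open neighbourhood `U` such that `T φ = 0` for all `φ ∈ C_c^∞` with `tsupport φ ⊆ U`.  Then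
`T φ = 0` for every `φ ∈ C_c^∞` with `tsupport φ ⊆ V` (finite subcover of `tsupport φ`, smooth
partition of unity subordinate to it, additivity). [folklore] -/
theorem apply_eq_zero_of_locally_zero {V : Set ℂ} (T : (ℂ → ℂ) → ℂ)
    (hadd : ∀ φ ψ : ℂ → ℂ, ContDiff ℝ ∞ φ → HasCompactSupport φ → tsupport φ ⊆ V →
      ContDiff ℝ ∞ ψ → HasCompactSupport ψ → tsupport ψ ⊆ V →
        T (fun x => φ x + ψ x) = T φ + T ψ)
    (hloc : ∀ y ∈ V, ∃ U : Set ℂ, IsOpen U ∧ y ∈ U ∧ ∀ φ : ℂ → ℂ, ContDiff ℝ ∞ φ →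
      HasCompactSupport φ → tsupport φ ⊆ U → T φ = 0)
    {φ : ℂ → ℂ} (hφ : ContDiff ℝ ∞ φ) (hφc : HasCompactSupport φ) (hφV : tsupport φ ⊆ V) :
    T φ = 0 := by
  classical
  choose U hUo hyU hU using hloc
  set U' : V → Set ℂ := fun y => U y y.2 with hU'
  have hcover : tsupport φ ⊆ ⋃ y : V, U' y := fun x hx =>
    mem_iUnion.2 ⟨⟨x, hφV hx⟩, hyU x (hφV hx)⟩
  obtain ⟨t, ht⟩ := hφc.isCompact.elim_finite_subcover U' (fun y => hUo y y.2) hcover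
  have ht' : tsupport φ ⊆ ⋃ i : t, U' i := fun x hx => by
    obtain ⟨i, hi, hx⟩ := mem_iUnion₂.1 (ht hx)
    exact mem_iUnion.2 ⟨⟨i, hi⟩, hx⟩
  obtain ⟨ρ, hρ⟩ := SmoothPartitionOfUnity.exists_isSubordinate (I := 𝓘(ℝ, ℂ)) (M := ℂ)
    (isClosed_tsupport _) (fun i : t => U' i) (fun i => hUo i.1 i.1.2) ht'
  have hρs : ∀ i, ContDiff ℝ ∞ (ρ i : ℂ → ℝ) := fun i => contMDiff_iff_contDiff.1 (ρ i).contMDiff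
  set ψ : t → ℂ → ℂ := fun i x => ((ρ i x : ℝ) : ℂ) * φ x with hψdef
  have hρC : ∀ i, ContDiff ℝ ∞ (fun x => ((ρ i x : ℝ) : ℂ)) := fun i =>
    Complex.ofRealCLM.contDiff.comp (hρs i)
  have hψd : ∀ i, ContDiff ℝ ∞ (ψ i) := fun i => (hρC i).mul hφ
  have hψc : ∀ i, HasCompactSupport (ψ i) := fun i =>
    hφc.mono (Function.support_mul_subset_right (fun x => ((ρ i x : ℝ) : ℂ)) φ)
  have hψV : ∀ i, tsupport (ψ i) ⊆ V := fun i =>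
    (tsupport_mul_subset_right (f := fun x => ((ρ i x : ℝ) : ℂ)) (g := φ)).trans hφV
  have hψU : ∀ i, tsupport (ψ i) ⊆ U' i := by
    intro i
    refine subset_trans ?_ (hρ i)
    refine (tsupport_mul_subset_left (f := fun x => ((ρ i x : ℝ) : ℂ)) (g := φ)).trans ?_
    refine closure_mono fun x hx => ?_
    simpa [Function.mem_support] using hx
  have hsum : φ = fun x => ∑ i ∈ (Finset.univ : Finset t), ψ i x := by
    funext x
    simp only [hψdef]
    by_cases hx : x ∈ tsupport φ
    · rw [← Finset.sum_mul, ← Complex.ofReal_sum, ← finsum_eq_sum_of_fintype, ρ.sum_eq_one hx,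
        Complex.ofReal_one, one_mul]
    · rw [image_eq_zero_of_notMem_tsupport hx]
      simp
  obtain ⟨-, -, -, hT⟩ := apply_sum_eq_sum T hadd (Finset.univ : Finset t) ψ hψd hψc hψV
  rw [hsum, hT]
  exact Finset.sum_eq_zero fun i _ => hU i.1 i.1.2 (ψ i) (hψd i) (hψc i) (hψU i)

/-! ### 2. Mollification with support control -/

/-- **Smooth uniform approximation with support inside a prescribed open set.** A continuous
compactly supported `φ : ℂ → ℂ` with `tsupport φ ⊆ V`, `V` open, is within `ε` (uniformly) of a
smooth compactly supported `ψ` with `tsupport ψ ⊆ V`: convolve with a normed bump of radius smaller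
than the uniform-continuity modulus of `φ` and than the room between `tsupport φ` and `Vᶜ`.
[folklore] -/
theorem exists_contDiff_dist_le_of_tsupport_subset {V : Set ℂ} (hV : IsOpen V) {φ : ℂ → ℂ}
    (hφ : Continuous φ) (hφc : HasCompactSupport φ) (hφV : tsupport φ ⊆ V) {ε : ℝ} (hε : 0 < ε) :
    ∃ ψ : ℂ → ℂ, ContDiff ℝ ∞ ψ ∧ HasCompactSupport ψ ∧ tsupport ψ ⊆ V ∧ ∀ x, ‖ψ x - φ x‖ ≤ ε := by
  obtain ⟨r₁, hr₁, hr₁V⟩ := hφc.isCompact.exists_cthickening_subset_open hV hφV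
  have huc : UniformContinuous φ := hφc.uniformContinuous_of_continuous hφ
  obtain ⟨r₂, hr₂, hr₂uc⟩ := Metric.uniformContinuous_iff.1 huc ε hε
  set r : ℝ := min r₁ r₂ / 2 with hr
  have hrpos : 0 < r := by positivity
  have hr₁' : r ≤ r₁ := by
    have := min_le_left r₁ r₂; rw [hr]; linarith [lt_min hr₁ hr₂]
  have hr₂' : r < r₂ := by
    have := min_le_right r₁ r₂; rw [hr]; linarith [lt_min hr₁ hr₂]
  let β : ContDiffBump (0 : ℂ) := ⟨r / 2, r, half_pos hrpos, half_lt_self hrpos⟩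
  refine ⟨β.normed volume ⋆[ContinuousLinearMap.lsmul ℝ ℝ, volume] φ, ?_, ?_, ?_, ?_⟩
  · exact β.hasCompactSupport_normed.contDiff_convolution_left _ β.contDiff_normed
      hφ.locallyIntegrable
  · exact β.hasCompactSupport_normed.convolution _ hφc
  · -- `tsupport ⊆ cthickening r (tsupport φ) ⊆ cthickening r₁ (tsupport φ) ⊆ V`
    have hsupp : Function.support (β.normed volume ⋆[ContinuousLinearMap.lsmul ℝ ℝ, volume] φ) ⊆
        thickening r (tsupport φ) := by
      refine (support_convolution_subset _).trans ?_
      rintro x ⟨a, ha, b, hb, rfl⟩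
      rw [β.support_normed_eq] at ha
      refine Metric.mem_thickening_iff.2 ⟨b, subset_tsupport _ hb, ?_⟩
      rw [dist_eq_norm]
      simpa using ha
    refine (closure_mono hsupp).trans ?_
    exact ((closure_thickening_subset_cthickening r _).trans (cthickening_mono hr₁' _)).trans hr₁V
  · intro x
    rw [← dist_eq_norm]
    refine β.dist_normed_convolution_le hφ.aestronglyMeasurable fun y hy => ?_
    exact (hr₂uc (lt_trans (mem_ball.1 hy) hr₂')).le

/-! ### 3. The density-at-a-point lemma of the ratio-mixing step -/

/-- **A sandwiched complex constant equals one.** Let `K ∈ ℂ`.  Suppose that for every `γ > 0`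
there are reals `J`, `V > 0` and a complex `P` with `K P = J`, `‖P − V‖ ≤ γ V` and `(1 − γ) V ≤ J`,
and also such data with instead `J ≤ (1 + γ) V`.  Then `K = 1`: `K = J/V − K (P − V)/V` has real
part `≥ 1 − γ − γ‖K‖` resp. `≤ 1 + γ + γ‖K‖` and imaginary part of size `≤ γ ‖K‖`. [folklore] -/
theorem eq_one_of_sandwich {K : ℂ}
    (hup : ∀ γ : ℝ, 0 < γ → ∃ (J V : ℝ) (P : ℂ), 0 < V ∧ (1 - γ) * V ≤ J ∧ ‖P - V‖ ≤ γ * V ∧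
      (J : ℂ) = K * P)
    (hdown : ∀ γ : ℝ, 0 < γ → ∃ (J V : ℝ) (P : ℂ), 0 < V ∧ J ≤ (1 + γ) * V ∧ ‖P - V‖ ≤ γ * V ∧
      (J : ℂ) = K * P) :
    K = 1 := by
  -- the basic decomposition `K = J/V - K (P - V)/V`
  have key : ∀ (J V : ℝ) (P : ℂ) (γ : ℝ), 0 < V → ‖P - V‖ ≤ γ * V → (J : ℂ) = K * P →
      |K.re - J / V| ≤ γ * ‖K‖ ∧ |K.im| ≤ γ * ‖K‖ := by
    intro J V P γ hV hP hJ
    have hV0 : (V : ℂ) ≠ 0 := Complex.ofReal_ne_zero.2 hV.ne'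
    have hdec : K - (J / V : ℝ) = -(K * (P - V) / V) := by
      push_cast
      rw [hJ]
      field_simp
      ring
    have hnorm : ‖K - (J / V : ℝ)‖ ≤ γ * ‖K‖ := by
      rw [hdec, norm_neg, norm_div, norm_mul, Complex.norm_real, Real.norm_of_nonneg hV.le,
        div_le_iff₀ hV]
      calc ‖K‖ * ‖P - V‖ ≤ ‖K‖ * (γ * V) := mul_le_mul_of_nonneg_left hP (norm_nonneg _)
        _ = γ * ‖K‖ * V := by ring
    constructor
    · have h := Complex.abs_re_le_norm (K - (J / V : ℝ))
      simp only [Complex.sub_re, Complex.ofReal_re] at h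
      exact h.trans hnorm
    · have h := Complex.abs_im_le_norm (K - (J / V : ℝ))
      simp only [Complex.sub_im, Complex.ofReal_im, sub_zero] at h
      exact h.trans hnorm
  have hre_ge : 1 ≤ K.re := by
    refine le_of_forall_pos_lt_add fun ε hε => ?_
    set γ : ℝ := ε / (2 * (1 + ‖K‖)) with hγ
    have hγpos : 0 < γ := by positivity
    obtain ⟨J, V, P, hV, hJ, hP, hJK⟩ := hup γ hγpos
    obtain ⟨h1, -⟩ := key J V P γ hV hP hJK
    have hJV : 1 - γ ≤ J / V := by rw [le_div_iff₀ hV]; exact hJ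
    have h2 : γ * (1 + ‖K‖) = ε / 2 := by rw [hγ]; field_simp
    rw [abs_le] at h1
    nlinarith [norm_nonneg K]
  have hre_le : K.re ≤ 1 := by
    refine le_of_forall_pos_lt_add fun ε hε => ?_
    set γ : ℝ := ε / (2 * (1 + ‖K‖)) with hγ
    have hγpos : 0 < γ := by positivity
    obtain ⟨J, V, P, hV, hJ, hP, hJK⟩ := hdown γ hγpos
    obtain ⟨h1, -⟩ := key J V P γ hV hP hJK
    have hJV : J / V ≤ 1 + γ := by rw [div_le_iff₀ hV]; exact hJ
    have h2 : γ * (1 + ‖K‖) = ε / 2 := by rw [hγ]; field_simp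
    rw [abs_le] at h1
    nlinarith [norm_nonneg K]
  have him : K.im = 0 := by
    have habs : |K.im| ≤ 0 := by
      refine le_of_forall_pos_lt_add fun ε hε => ?_
      set γ : ℝ := ε / (2 * (1 + ‖K‖)) with hγ
      have hγpos : 0 < γ := by positivity
      obtain ⟨J, V, P, hV, -, hP, hJK⟩ := hup γ hγpos
      obtain ⟨-, h1⟩ := key J V P γ hV hP hJK
      have h2 : γ * (1 + ‖K‖) = ε / 2 := by rw [hγ]; field_simp
      nlinarith [norm_nonneg K, abs_nonneg K.im]
    exact abs_eq_zero.1 (le_antisymm habs (abs_nonneg _))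
  apply Complex.ext
  · simp only [Complex.one_re]; exact le_antisymm hre_le hre_ge
  · simp only [Complex.one_im]; exact him

/-! ### 4. Slices of flat-top bumps on an interval -/

/-- **Lower bound for the mass of a flat-top bump**: if `0 ≤ w`, `w = 1` on `[x₀ - r₁, x₀ + r₁]`
and `r₁ ≤ R`, then `2 r₁ ≤ ∫_{(x₀ - R, x₀ + R)} w`. [folklore] -/
theorem two_mul_le_integral_bump {w : ℝ → ℝ} {x₀ r₁ R : ℝ} (hw : Continuous w)
    (hw0 : ∀ x, 0 ≤ w x) (hw1 : ∀ x, |x - x₀| ≤ r₁ → w x = 1) (hr₁ : 0 ≤ r₁) (hR : r₁ ≤ R) :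
    2 * r₁ ≤ ∫ x in Set.Ioo (x₀ - R) (x₀ + R), w x := by
  have hint : IntegrableOn w (Set.Ioo (x₀ - R) (x₀ + R)) :=
    (hw.integrableOn_Icc).mono_set Set.Ioo_subset_Icc_self
  have hsub : Set.Icc (x₀ - r₁) (x₀ + r₁) ⊆ Set.Ioo (x₀ - R) (x₀ + R) ∪ {x₀ - R, x₀ + R} := by
    intro x hx
    rcases eq_or_lt_of_le (show x₀ - R ≤ x by linarith [hx.1]) with h | h
    · exact Or.inr (Or.inl h.symm)
    rcases eq_or_lt_of_le (show x ≤ x₀ + R by linarith [hx.2]) with h' | h'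
    · exact Or.inr (Or.inr h')
    · exact Or.inl ⟨h, h'⟩
  calc 2 * r₁ = ∫ x in Set.Icc (x₀ - r₁) (x₀ + r₁), (1 : ℝ) := by
        rw [setIntegral_const, Real.volume_real_Icc_of_le (by linarith), smul_eq_mul, mul_one]; ring
    _ = ∫ x in Set.Icc (x₀ - r₁) (x₀ + r₁), w x := by
        refine setIntegral_congr_fun measurableSet_Icc fun x hx => (hw1 x ?_).symm
        rw [abs_le]; constructor <;> linarith [hx.1, hx.2]
    _ ≤ ∫ x in Set.Ioo (x₀ - R) (x₀ + R), w x := by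
        have hae : Set.Icc (x₀ - r₁) (x₀ + r₁) ≤ᵐ[volume] Set.Ioo (x₀ - R) (x₀ + R) := by
          refine hsub.eventuallyLE.trans ?_
          have h0 : ({x₀ - R, x₀ + R} : Set ℝ) =ᵐ[volume] (∅ : Set ℝ) := by
            rw [ae_eq_empty]
            exact (Set.toFinite _).measure_zero _
          have := (ae_eq_refl (Set.Ioo (x₀ - R) (x₀ + R))).union h0
          rw [union_empty] at this
          exact this.le
        exact setIntegral_mono_set hint (Eventually.of_forall fun x => hw0 x) hae

/-- **Upper bound for the mass of a bump**: if `0 ≤ w ≤ 1` and `w = 0` off `(x₀ - r₂, x₀ + r₂)`,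
then `∫_{(x₀ - R, x₀ + R)} w ≤ 2 r₂` (`0 ≤ r₂`). [folklore] -/
theorem integral_bump_le_two_mul {w : ℝ → ℝ} {x₀ r₂ R : ℝ}
    (hw0 : ∀ x, 0 ≤ w x) (hwle : ∀ x, w x ≤ 1) (hw2 : ∀ x, r₂ ≤ |x - x₀| → w x = 0) (hr₂ : 0 ≤ r₂) :
    ∫ x in Set.Ioo (x₀ - R) (x₀ + R), w x ≤ 2 * r₂ := by
  have h1 : ∫ x in Set.Ioo (x₀ - R) (x₀ + R), w x =
      ∫ x in Set.Ioo (x₀ - R) (x₀ + R) ∩ Set.Ioo (x₀ - r₂) (x₀ + r₂), w x := by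
    refine (setIntegral_eq_of_subset_of_forall_sdiff_eq_zero measurableSet_Ioo inter_subset_left
      fun x hx => hw2 x ?_)
    have hx2 : x ∉ Set.Ioo (x₀ - r₂) (x₀ + r₂) := fun h => hx.2 ⟨hx.1, h⟩
    rw [Set.mem_Ioo, not_and_or, not_lt, not_lt] at hx2
    rw [le_abs]
    rcases hx2 with h | h
    · right; linarith
    · left; linarith
  rw [h1]
  have hvol : volume (Set.Ioo (x₀ - R) (x₀ + R) ∩ Set.Ioo (x₀ - r₂) (x₀ + r₂)) < ⊤ :=
    lt_of_le_of_lt (measure_mono inter_subset_right) measure_Ioo_lt_top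
  have h2 := norm_setIntegral_le_of_norm_le_const hvol (C := 1) (f := w) fun x _ => by
    rw [Real.norm_of_nonneg (hw0 x)]; exact hwle x
  have h3 : volume.real (Set.Ioo (x₀ - R) (x₀ + R) ∩ Set.Ioo (x₀ - r₂) (x₀ + r₂)) ≤ 2 * r₂ := by
    calc volume.real (Set.Ioo (x₀ - R) (x₀ + R) ∩ Set.Ioo (x₀ - r₂) (x₀ + r₂))
        ≤ volume.real (Set.Ioo (x₀ - r₂) (x₀ + r₂)) :=
          measureReal_mono inter_subset_right measure_Ioo_lt_top.ne
      _ = 2 * r₂ := by rw [Real.volume_real_Ioo_of_le (by linarith)]; ring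
  have h4 : ∫ x in Set.Ioo (x₀ - R) (x₀ + R) ∩ Set.Ioo (x₀ - r₂) (x₀ + r₂), w x ≤
      ‖∫ x in Set.Ioo (x₀ - R) (x₀ + R) ∩ Set.Ioo (x₀ - r₂) (x₀ + r₂), w x‖ := Real.le_norm_self _
  linarith

/-- **A bump averages a continuous density**: if `0 ≤ w`, `w = 0` off `(x₀ - r₂, x₀ + r₂)`,
`‖E x - 1‖ ≤ γ` for `|x - x₀| < r₂`, `w` continuous and `E` continuous on `[x₀ - R, x₀ + R]`, then
`‖∫ w E - ∫ w‖ ≤ γ ∫ w` (integrals over `(x₀ - R, x₀ + R)`). [folklore] -/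
theorem norm_integral_bump_mul_sub_le {w : ℝ → ℝ} {E : ℝ → ℂ} {x₀ r₂ R γ : ℝ} (hw : Continuous w)
    (hw0 : ∀ x, 0 ≤ w x) (hw2 : ∀ x, r₂ ≤ |x - x₀| → w x = 0)
    (hE : ContinuousOn E (Set.Icc (x₀ - R) (x₀ + R))) (hγ : ∀ x, |x - x₀| < r₂ → ‖E x - 1‖ ≤ γ) :
    ‖(∫ x in Set.Ioo (x₀ - R) (x₀ + R), (w x : ℂ) * E x) -
        ((∫ x in Set.Ioo (x₀ - R) (x₀ + R), w x : ℝ) : ℂ)‖ ≤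
      γ * ∫ x in Set.Ioo (x₀ - R) (x₀ + R), w x := by
  have hwI : IntegrableOn w (Set.Ioo (x₀ - R) (x₀ + R)) :=
    (hw.integrableOn_Icc).mono_set Set.Ioo_subset_Icc_self
  have hwC : Continuous fun x => (w x : ℂ) := Complex.continuous_ofReal.comp hw
  have hwEI : IntegrableOn (fun x => (w x : ℂ) * E x) (Set.Ioo (x₀ - R) (x₀ + R)) :=
    ((hwC.continuousOn.mul hE).integrableOn_Icc).mono_set Set.Ioo_subset_Icc_self
  have hwCI : IntegrableOn (fun x => (w x : ℂ)) (Set.Ioo (x₀ - R) (x₀ + R)) :=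
    (hwC.integrableOn_Icc).mono_set Set.Ioo_subset_Icc_self
  rw [← integral_complex_ofReal, ← integral_sub hwEI hwCI]
  have hpt : ∀ x, ‖(w x : ℂ) * E x - (w x : ℂ)‖ ≤ w x * γ := by
    intro x
    rw [← mul_sub_one, norm_mul, Complex.norm_real, Real.norm_of_nonneg (hw0 x)]
    by_cases hx : |x - x₀| < r₂
    · exact mul_le_mul_of_nonneg_left (hγ x hx) (hw0 x)
    · rw [hw2 x (not_lt.1 hx)]; simp
  calc ‖∫ x in Set.Ioo (x₀ - R) (x₀ + R), (w x : ℂ) * E x - (w x : ℂ)‖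
      ≤ ∫ x in Set.Ioo (x₀ - R) (x₀ + R), w x * γ :=
        norm_integral_le_of_norm_le (hwI.mul_const γ) (Eventually.of_forall hpt)
    _ = γ * ∫ x in Set.Ioo (x₀ - R) (x₀ + R), w x := by rw [integral_mul_const, mul_comm]

/-! ### Registered form (sub-goal of `gateProfile_of_identification`) -/

/-- **Registered sub-goal `gateProfile_localToGlobal`** (crux item stmt-CriticalPhenomena-14004, line
`polygon-parity-squeeze`, stub `gateProfile_of_identification`, piece F of the (A) assembly): registry
form (one `∀`-term) of `apply_eq_zero_of_locally_zero` — an additive functional on `C_c^∞(V)` that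
vanishes locally vanishes. [folklore] -/
theorem gateProfile_localToGlobal : ∀ (V : Set ℂ) (T : (ℂ → ℂ) → ℂ), (∀ φ ψ : ℂ → ℂ, ContDiff ℝ ∞ φ → HasCompactSupport φ → tsupport φ ⊆ V → ContDiff ℝ ∞ ψ → HasCompactSupport ψ → tsupport ψ ⊆ V → T (fun x => φ x + ψ x) = T φ + T ψ) → (∀ y ∈ V, ∃ U : Set ℂ, IsOpen U ∧ y ∈ U ∧ ∀ φ : ℂ → ℂ, ContDiff ℝ ∞ φ → HasCompactSupport φ → tsupport φ ⊆ U → T φ = 0) → ∀ φ : ℂ → ℂ, ContDiff ℝ ∞ φ → HasCompactSupport φ → tsupport φ ⊆ V → T φ = 0 :=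
  fun _ T hadd hloc _ hφ hφc hφV => apply_eq_zero_of_locally_zero T hadd hloc hφ hφc hφV

end Summit.CriticalPhenomena.SAWScalingLimit.Theorems.PolygonParitySqueeze.GateProfile

end
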